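import Mathlib
import HarnessLib
import Summits.ValiantsHypothesis.ValiantsHypothesis.Theses.MonotoneRestoration
import Literature.Computability.AlgebraicComplexity.ArithCircuit
import Literature.Computability.AlgebraicComplexity.ArithCircuitProofs
import Literature.Computability.AlgebraicComplexity.MonotoneStructure
import Literature.Computability.AlgebraicComplexity.PermanentIrreducible
import Literature.ModelTheory.FiniteModelTheory.CkEquiv
import Summits.ValiantsHypothesis.ValiantsHypothesis.Theorems.MonotoneRestorationMonotoneRestorationQPCosetCount
import Summits.ValiantsHypothesis.ValiantsHypothesis.Theorems.MonotoneRestorationMonotoneRestorationQPSymmetricLB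
import Summits.ValiantsHypothesis.ValiantsHypothesis.Theorems.MonotoneRestorationMonotoneRestorationQPSupportSymmetrisation
import Summits.ValiantsHypothesis.ValiantsHypothesis.Theorems.MonotoneRestorationMonotoneRestorationQPSparseRegime
import Summits.ValiantsHypothesis.ValiantsHypothesis.Theorems.MonotoneRestorationMonotoneRestorationQPBeta
import Literature.Computability.AlgebraicComplexity.SymmetricArithCircuit
import Literature.Computability.AlgebraicComplexity.DawarWilsenach2025Proofs
import Literature.GroupTheory.PermutationGroups.SmallIndexSubgroups
import Summits.ValiantsHypothesis.ValiantsHypothesis.Theorems.MonotoneRestorationQP.Negative.LoadBearing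
import Summits.ValiantsHypothesis.ValiantsHypothesis.Theorems.MonotoneRestorationMonotoneRestorationQPPermSupportCount

/-! TTRL-lite variant V19907 of stmt-ValiantsHypothesis-15886 -/

-- `ValiantsHypothesis.ValiantsHypothesis`: the D-0017 layout repeats the problem name in the path.
set_option linter.dupNamespace false

namespace Summit.ValiantsHypothesis.ValiantsHypothesis.Theorems

open Summit.ValiantsHypothesis.ValiantsHypothesis.Theses.MonotoneRestoration
open Literature.Computability.AlgebraicComplexity

/-- **Shift-embedding of supports bounds the total degree** (TTRL-lite variant V19907 of
`stub_mulGate_children_extend`; the degree bookkeeping used all along the multiplication-gate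
spine). If every monomial `m` of `p` extends, by a common shift `μ`, to a monomial `m + μ` of
`f`, then `totalDegree p ≤ totalDegree f`: for each `m ∈ p.support`,
`deg m ≤ deg m + deg μ = deg (m + μ) ≤ totalDegree f`, and `totalDegree p` is the supremum of
`deg m` over the support (so the claim is trivial when `p = 0`). [folklore] -/
theorem stub_mulGate_children_extend_var19907 :
    ∀ (n : ℕ) (p f : MvPolynomial (Fin n × Fin n) NNReal),
      (∃ μ : (Fin n × Fin n) →₀ ℕ, ∀ m ∈ p.support, m + μ ∈ f.support) →
      p.totalDegree ≤ f.totalDegree := by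
  intro n p f hext
  obtain ⟨μ, hμ⟩ := hext
  rw [MvPolynomial.totalDegree]
  refine Finset.sup_le fun m hm => ?_
  -- the degree of an exponent vector is additive
  have hdeg_add : ((m + μ).sum fun _ e => e) = (m.sum fun _ e => e) + (μ.sum fun _ e => e) :=
    Finsupp.sum_add_index' (fun _ => rfl) (fun _ _ _ => rfl)
  have key := MvPolynomial.le_totalDegree (hμ m hm)
  rw [hdeg_add] at key
  omega

end Summit.ValiantsHypothesis.ValiantsHypothesis.Theorems
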